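import Mathlib
import Summits.QuantumFields.YangMills.Theses.HyperbolicRegulator
import Literature.Probability.LatticeModels.CoarseCellFiniteSize
import Literature.MathematicalPhysics.QuantumLattice.LatticeGaugeDLR

/-!
# Strategist sketch — crux `CurvatureUniformity` (stmt-QuantumFields-15825)

Typed artefacts referenced by `STRATEGY-CENSUS.md` (crux-strategist seat
`planner-cstrat-stmt-QuantumFields-15825-b1-0`, 2026-08-17):

1. `SparseIslandPathBound` — the FIRST LEMMA of the (post-restate) transfer line
   `sparse-apex-window-transfer`: on a bounded-degree graph, a set of "wild" vertices made of islands of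
   diameter `≤ D₀` pairwise `≥ R` apart does not spoil a subcritical path-weight sum (the combinatorial
   core of disagreement percolation with deterministic sparse defects; van den Berg–Maes 1994 §2,
   Dobrushin–Shlosman 1985 §2–3, tree engine `Literature.Probability.LatticeModels.influence_decay_markov_defects`).
2. `FlatWindow`, `FlatWindowsAtWeakCoupling` — the kernel K of the crux in WINDOW CURRENCY: the
   worst-case Dobrushin–Shlosman finite-size condition (tree `IsGoodFS` with `good ≡ univ`, here written
   directly for `ymSpecification` on `ℤ⁴` with cells of side `L`) at every `β ≥ β₁`.
3. `FlatR`, `ConeChartClause`, `DiscClause` — typed advice for the pending lockstep restate of the shared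
   `Fam` admissibility predicate of items 15825/15826/15827 (refuter evidence R3 / VETTING): the repaired
   flat predicate (threshold `k/2`), 5-quadrant CONE CHARTS of radius `k/2` at every degree-5 vertex, and a
   DISC (girth) clause `χ(B(x,r)) = 1` for `r ≤ j/2`.
Nothing here is an item or a stub; the file only certifies that the signatures elaborate.
-/

set_option autoImplicit false

noncomputable section

namespace Summit.QuantumFields.YangMills.Cruxes.CurvatureUniformity.Strategist

open Classical
open MeasureTheory

/-! ## 1. First lemma of the transfer line: sparse wild islands do not spoil a subcritical path sum -/

/-- **Sparse-island path bound.** `Γ` a connected finite graph of maximal degree `≤ Δ`; `W` a set of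
wild vertices such that any two wild vertices are either `≤ D₀` apart (same island) or `≥ R` apart, with
`2 D₀ < R`; weights `w v ∈ [0,1]`, `w v ≤ ε` off `W`. A self-avoiding path of length `n` meets at most
`n / R + 1` islands and at most `N₀ = Δ^(D₀+1)` vertices of each, so the total weight of all
self-avoiding paths from `x` to `y` is `≤ ε^(1-N₀) θ^dist(x,y) / (1-θ)` with `θ = Δ ε^(1 - N₀/R)`,
whenever `θ < 1`. -/
def SparseIslandPathBound : Prop :=
  ∀ (V : Type) [Fintype V] [DecidableEq V] (Γ : SimpleGraph V) [DecidableRel Γ.Adj]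
    (Δ D₀ R : ℕ) (W : Finset V) (w : V → ℝ) (ε : ℝ),
    Γ.Connected →
    (∀ v, Γ.degree v ≤ Δ) →
    2 * D₀ < R →
    (∀ u ∈ W, ∀ v ∈ W, Γ.dist u v ≤ D₀ ∨ R ≤ Γ.dist u v) →
    0 < ε → ε ≤ 1 →
    (∀ v, 0 ≤ w v ∧ w v ≤ 1) → (∀ v, v ∉ W → w v ≤ ε) →
    let N₀ : ℕ := Δ ^ (D₀ + 1)
    let θ : ℝ := (Δ : ℝ) * ε ^ (1 - (N₀ : ℝ) / R)
    θ < 1 →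
    ∀ x y : V,
      ∑ n ∈ Finset.range (Fintype.card V),
          ∑ p ∈ (Γ.finsetWalkLength n x y).filter (fun p => p.IsPath),
            ∏ v ∈ p.support.toFinset, w v
        ≤ ε ^ (1 - (N₀ : ℝ)) * θ ^ Γ.dist x y / (1 - θ)

/-! ## 2. The kernel K in window currency (flat Dobrushin–Shlosman window for Wilson's specification) -/

open Literature.Probability.LatticeModels Literature.MathematicalPhysics.QuantumLattice in
/-- **Flat window** `W(β; L, n, ε)`: cells of `ℤ⁴`-edges of side `L` (cell of the edge `(x,i)` =
`⌊x/L⌋`); for every cell-union `A` inside the cube of `(4n+1)⁴` cells around the origin cell, every two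
exterior data agreeing on that cube, and every `[0,1]`-valued measurable observable of the origin cell, the
Wilson kernels `γ_A(f | ζ)`, `γ_A(f | ζ')` (tree `ymSpecification`) differ by at most `ε`. This is the
worst-case (good ≡ univ) total-variation finite-size condition of Dobrushin–Shlosman read through cells,
i.e. tree `IsGoodFS` specialised to the flat Wilson specification. -/
def FlatWindow {G : Type} [Group G] [TopologicalSpace G] [IsTopologicalGroup G] [CompactSpace G]
    [MeasurableSpace G] [BorelSpace G] {N : ℕ} (ρ : G →* Matrix (Fin N) (Fin N) ℂ)
    (β : ℝ) (L n : ℕ) (ε : ℝ) : Prop :=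
  let cellOf : ZdEdge 4 → (Fin 4 → ℤ) := fun e i => e.1 i / (L : ℤ)
  ∀ A : Finset (ZdEdge 4),
    (∀ e ∈ A, ∀ i, |cellOf e i| ≤ (2 * n : ℤ)) →
    (∀ e e', cellOf e = cellOf e' → e ∈ A → e' ∈ A) →
    ∀ ζ ζ' : LGConfig 4 G, (∀ e, (∀ i, |cellOf e i| ≤ (2 * n : ℤ)) → ζ e = ζ' e) →
    ∀ f : LGConfig 4 G → ℝ, Measurable f → (∀ U, 0 ≤ f U ∧ f U ≤ 1) →
      DependsOn f {e | cellOf e = 0} →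
        |∫ U, f U ∂(ymSpecification (d := 4) ρ β A ζ) - ∫ U, f U ∂(ymSpecification (d := 4) ρ β A ζ')|
          ≤ ε

open Literature.MathematicalPhysics.QuantumFieldTheory in
/-- **T_flat — flat windows at every weak coupling** (the kernel K of `CurvatureUniformity` in window
currency; a DETECTOR of the massive phase at scale `L(β) ≳ ξ(β)`; false for `U(1)`): for every compact
simple `G` and faithful unitary `r` there is `β₁` such that for every `β ≥ β₁` some cell side `L`, window
`n` and threshold `ε` with the Dobrushin–Shlosman smallness `ε · #shell ≤ 3/4` realise `FlatWindow`. -/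
def FlatWindowsAtWeakCoupling : Prop :=
  ∀ (G : Type) [Group G] [TopologicalSpace G] [IsTopologicalGroup G] [CompactSpace G],
    IsCompactSimpleLieGroup G → letI : MeasurableSpace G := borel G; haveI : BorelSpace G := ⟨rfl⟩;
    ∀ r : LatticeRep G, ∃ β₁ : ℝ, ∀ β : ℝ, β₁ ≤ β → ∃ (L n : ℕ) (ε : ℝ), 0 < L ∧ 0 ≤ ε ∧
      ε * (((4 * n + 3) ^ 4 - (4 * n + 1) ^ 4 : ℕ) : ℝ) ≤ 3 / 4 ∧ FlatWindow r.ρ β L n ε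

/-! ## 3. Typed advice for the lockstep restate of the `Fam` admissibility predicate -/

section Restate

variable (k j : ℕ) (V E Q : Finset ℕ) (σ τ : ℕ → ℕ) (bd : ℕ → Fin 4 → ℕ × Bool)

/-- The route's vertex graph `Γ` (verbatim sub-vocabulary of `Fam`). -/
def coneGraph : SimpleGraph ℕ := SimpleGraph.fromRel fun a b : ℕ => ∃ e ∈ E, σ e = a ∧ τ e = b

/-- The route's degree function `dg`. -/
def dg (x : ℕ) : ℕ := (E.filter fun e => σ e = x ∨ τ e = x).card

/-- The route's cone set `K` (degree-5 vertices). -/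
def cones : Finset ℕ := V.filter fun x => dg E σ τ x = 5

/-- The route's `st` (start vertex of an oriented edge). -/
def st (e : ℕ × Bool) : ℕ := if e.2 then σ e.1 else τ e.1

/-- **(R-a)** the refuters' repaired flat predicate: flat points are MORE than `k/2` from every cone, so a
flat chart (an `ℓ^∞` box of radius `k/4`, graph reach `k/2`) never contains a cone. -/
def FlatR (x : ℕ) : Prop := x ∈ V ∧ ∀ c ∈ cones V E σ τ, k / 2 < (coneGraph E σ τ).dist x c

/-- **(R-b) cone charts.** Data `cK c s (a,b)`: the vertex at coordinates `(a,b)`, `1 ≤ a ≤ k/2`,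
`0 ≤ b ≤ k/2`, of quadrant `s : Fin 5` around the cone `c` (the ray `a = 0` of quadrant `s` is the ray
`b = 0` of quadrant `s+1`; the apex is `c`). The clause: the normalised model map `P` lands in `V`, is
injective, sends model edges to edges of `Γ` and model unit squares to squares of `Q` (as vertex sets), and
is ONTO the ball of radius `k/2` around `c` (so nothing exotic hides near a cone: with cone separation `≥ k`
every interior model vertex then has exactly its four model edges). Holds for `k`-subdivided `{4,5}` covers
by inspection (the five subdivided big squares at an original vertex). -/
def ConeChartClause (cK : ℕ → Fin 5 → ℕ × ℕ → ℕ) : Prop :=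
  let Γ := coneGraph E σ τ
  let R := k / 2
  let P := fun (c : ℕ) (s : Fin 5) (a b : ℕ) =>
    if a = 0 ∧ b = 0 then c else if a = 0 then cK c (s + 1) (b, 0) else cK c s (a, b)
  ∀ c ∈ cones V E σ τ,
    (∀ (s : Fin 5) (a b : ℕ), a ≤ R → b ≤ R → P c s a b ∈ V) ∧
    (∀ (s : Fin 5) (a b : ℕ), 1 ≤ a → a ≤ R → b ≤ R → cK c s (a, b) ≠ c) ∧
    (∀ (s s' : Fin 5) (a a' b b' : ℕ), 1 ≤ a → a ≤ R → b ≤ R → 1 ≤ a' → a' ≤ R → b' ≤ R →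
        cK c s (a, b) = cK c s' (a', b') → s = s' ∧ a = a' ∧ b = b') ∧
    (∀ (s : Fin 5) (a b : ℕ), a + 1 ≤ R → b ≤ R → Γ.Adj (P c s a b) (P c s (a + 1) b)) ∧
    (∀ (s : Fin 5) (a b : ℕ), a ≤ R → b + 1 ≤ R → Γ.Adj (P c s a b) (P c s a (b + 1))) ∧
    (∀ (s : Fin 5) (a b : ℕ), a + 1 ≤ R → b + 1 ≤ R → ∃ q ∈ Q,
        Finset.univ.image (st σ τ ∘ bd q) =
          {P c s a b, P c s (a + 1) b, P c s a (b + 1), P c s (a + 1) (b + 1)}) ∧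
    (∀ x ∈ V, Γ.dist x c ≤ R → ∃ (s : Fin 5) (a b : ℕ), a + b ≤ R ∧ P c s a b = x)

/-- **(R-c) disc (girth) clause.** Every closed graph ball of radius `r ≤ j/2` has Euler characteristic
`#vertices − #edges + #squares = 1` for the induced subcomplex — so every cycle of length `≤ j` bounds inside
its own ball (no non-contractible cycle, hence no flat cylinder = finite-temperature geometry, of
circumference `≤ j`), and the diameter exceeds `j/2`. For a closed surface-complex `χ(B) ≤ 1` always, with
equality iff `H₁(B) = 0`. The restating seat must confirm `χ = 1` for graph balls below the injectivity radius
of the `k`-subdivided `{4,5}` geometry (true for `ℓ¹`-balls of `ℤ²`; near a `5`-cone by a Mayer–Vietoris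
check), else use the homotopy form "every closed walk of length `≤ j` is null-homotopic by backtrack and
square moves". -/
def DiscClause : Prop :=
  let Γ := coneGraph E σ τ
  ∀ x ∈ V, ∀ r : ℕ, r ≤ j / 2 →
    ((V.filter fun y => Γ.dist x y ≤ r).card : ℤ)
      - ((E.filter fun e => Γ.dist x (σ e) ≤ r ∧ Γ.dist x (τ e) ≤ r).card : ℤ)
      + ((Q.filter fun q => ∀ i, Γ.dist x (st σ τ (bd q i)) ≤ r).card : ℤ) = 1

end Restate

end Summit.QuantumFields.YangMills.Cruxes.CurvatureUniformity.Strategist
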